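import Literature.NumberTheory.GaloisRepresentations.LocalDualityTwoZero
import HarnessLib

/-!
# Local Tate duality in bidegree `(2, 0)`: the pairing SEPARATES `H²(F, M)`

Companion of `LocalDualityTwoZero.lean` (Serre, *Cohomologie galoisienne*, II §5.2 Thm. 2, `i = 2`;
Milne, *ADT*, I Cor. 2.3: `H²(F, M) ≅ H⁰(F, M^D)^*`). That file proves, for a non-archimedean local field
`F` of characteristic `0` and a finite discrete `Γ_F`-module `M` killed by `p^k`, the NUMERICAL form
`|H²(F, M)| = |Hom_{Γ_F}(M, μ_{p^k})|`; on the way it establishes, but does not export, the surjectivity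
of `f ↦ ⟨·, f⟩_F` onto `Hom(H²(F, M), ℤ/p^k)`. This file exports that surjectivity
(`ContinuousRep.twoZero_surjective_local`, the same proof: Sylow descent to `E/F` with `p ∤ [E:F]` and
`μ_p ⊂ E`, the dévissage `twoZero_surjective_of_devissage` over `Gal(F̄/E)`, and the projection
formula `cor ∘ H²(ev_{f'}) ∘ res = H²(N ev_{f'})`) and its consequence used by limit arguments:

* `ContinuousRep.exists_invariant_cohomologyMap_two_ne_zero` — **a non-zero class `z ∈ H²(F, M)` is
  detected by some invariant `f ∈ Hom_{Γ_F}(M, μ_{p^k})`: `H²(ev_f) z ≠ 0` in `H²(F, μ_{p^k})`**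
  (`ev_f : M → μ_{p^k}`, `m ↦ f m`).

No definition, no named fact, no `sorry`.

## References
* J.-P. Serre, *Galois Cohomology*, Springer, 1997, II §5.2 Thm. 2. [SerreGaloisCohomology1997]
* J. S. Milne, *Arithmetic Duality Theorems*, 2006, I Cor. 2.3. [MilneADT2006]
-/

noncomputable section

open CategoryTheory Function
open Field IsNonarchimedeanLocalField ValuativeRel IntermediateField

universe u

namespace Literature.NumberTheory.GaloisRepresentations

open _root_.TopRep _root_.ContRepresentation _root_.ContinuousCohomology DiscreteGaloisModule
open LocalWeilDatum

namespace ContinuousRep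

section Local

variable (F : Type u) [Field F] [ValuativeRel F] [TopologicalSpace F] [IsNonarchimedeanLocalField F] [CharZero F]
variable {M : Type u} [AddCommGroup M] [TopologicalSpace M] [DiscreteTopology M] [Finite M]

/-- **Local Tate duality in bidegree `(2, 0)`, surjectivity of `f ↦ ⟨·, f⟩_F`**: for a non-archimedean
local field `F` of characteristic `0`, a finite discrete `Γ_F`-module `M` killed by `p^k` and ANY injective
`ι : H²(F, μ_{p^k}) → ℤ/p^k`, every additive `λ : H²(F, M) → ℤ/p^k` is `z ↦ ι(H²(ev_f) z)` for some
invariant `f ∈ Hom_{Γ_F}(M, μ_{p^k})`. (The surjectivity half of `|H²(F, M)| = |H⁰(F, M^D)|`; proof as in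
`natCard_two_eq_natCard_invariants_homRep`.)
[cite: SerreGaloisCohomology1997, II §5.2 Thm. 2] [cite: MilneADT2006, I Cor. 2.3] -/
theorem twoZero_surjective_local {p k : ℕ} [hp : Fact p.Prime]
    (ρ : ContinuousRep (absoluteGaloisGroup F) ℤ M) (hM : ∀ m : M, p ^ k • m = 0)
    (ιF : continuousCohomology 2 (mu F (p ^ k)).toTopRep →+ ZMod (p ^ k)) (hιF : Injective ιF)
    (lam : continuousCohomology 2 ρ.toTopRep →+ ZMod (p ^ k)) :
    ∃ (f : HomCarrier M (MuCarrier F (p ^ k))) (hf : ∀ g, ρ.homRep (mu F (p ^ k)) g f = f),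
      ρ.twoZero (mu F (p ^ k)) ιF f hf = lam := by
  classical
  haveI := absoluteGaloisGroup_compactSpace F
  haveI : NeZero (p ^ k) := ⟨pow_ne_zero k hp.out.ne_zero⟩
  haveI : Finite (MuCarrier F (p ^ k)) := finite_muCarrier F (p ^ k)
  haveI : Finite (MuCarrier F p) := finite_muCarrier F p
  have eΩ := muEquivZMod F (p ^ k)
  have hpM : IsPrimaryTorsion p M := fun m => ⟨k, hM m⟩
  -- the trivial module
  by_cases hsub : Subsingleton M
  · haveI := subsingleton_continuousCohomology_of_subsingleton ρ.toTopRep 1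
    exact ⟨0, fun g => map_zero _, AddMonoidHom.ext fun z => by
      rw [Subsingleton.elim z 0, map_zero, map_zero]⟩
  haveI : Nontrivial M := not_subsingleton_iff_nontrivial.1 hsub
  have hk : k ≠ 0 := by
    rintro rfl
    obtain ⟨m, hm⟩ := exists_ne (0 : M)
    exact hm (by simpa using hM m)
  have hpn : p ∣ p ^ k := dvd_pow_self p hk
  -- `E/F`: a Sylow `p`-subgroup of the image of `Γ_F` on `M × μ_n`
  obtain ⟨S', hopen, hidx, N₀, hN₀, hfin, hP, htriv⟩ :=
    exists_subgroup_index_coprime_isPGroup (ρ.prod (mu F (p ^ k))) p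
  obtain ⟨E, hEfin, hE⟩ := exists_galFixing_eq_of_isOpen S' hopen
  subst hE
  haveI := hEfin
  haveI := hN₀
  haveI := hfin
  haveI : IsClosed ((galFixing F E : Subgroup (absoluteGaloisGroup F)) : Set (absoluteGaloisGroup F)) :=
    isClosed_galFixing' F E
  haveI : CompactSpace (galFixing F E) := compactSpace_of_isClosed_subgroup
  haveI : Finite (absoluteGaloisGroup F ⧸ galFixing F E) := finite_quot_galFixing F E
  letI : Fintype (absoluteGaloisGroup F ⧸ galFixing F E) := Fintype.ofFinite _
  have hN₀M : ∀ g ∈ N₀, ∀ m : M, ρ (g : absoluteGaloisGroup F) m = m := fun g hg m =>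
    congrArg Prod.fst (htriv g hg (m, 0))
  have hN₀Ω : ∀ g ∈ N₀, ∀ v : MuCarrier F (p ^ k), mu F (p ^ k) (g : absoluteGaloisGroup F) v = v :=
    fun g hg v => congrArg Prod.snd (htriv g hg (0, v))
  -- `μ_p` is fixed by `Gal(F̄/E)`
  have hμ : ∀ (g : galFixing F E) (v : MuCarrier F p), mu F p (g : absoluteGaloisGroup F) v = v := by
    have hinj : Injective (muInclusion F hpn) := fun a b h =>
      muVal_injective F p (by rw [← muVal_muInclusion F hpn a, h, muVal_muInclusion])
    have hN₀p : ∀ g ∈ N₀, ∀ v : MuCarrier F p,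
        (mu F p).restrict (subgroupIncl (galFixing F E)) g v = v := fun g hg v =>
      hinj ((TopRep.hom_comm_apply (muInclHom F hpn) (g : absoluteGaloisGroup F) v).trans (hN₀Ω g hg _))
    have hprim : IsPrimaryTorsion p (MuCarrier F p) := fun v =>
      ⟨1, muVal_injective F p (by rw [pow_one, muVal_nsmul, muVal_pow_eq_one, muVal_zero])⟩
    have hcardp : Nat.card (MuCarrier F p) = p :=
      (Nat.card_congr (muEquivZMod F p).toEquiv).trans (Nat.card_zmod p)
    haveI : Nontrivial (MuCarrier F p) :=
      Finite.one_lt_card_iff_nontrivial.1 (by rw [hcardp]; exact hp.out.one_lt)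
    obtain ⟨b, hb0, hb⟩ := exists_ne_zero_forall_apply_eq N₀ hP
      ((mu F p).restrict (subgroupIncl (galFixing F E))) hprim hN₀p
    intro g v
    obtain ⟨c, rfl⟩ := AddSubgroup.mem_zmultiples_iff.1
      (ContinuousRep.forall_mem_zmultiples_of_card hcardp hb0 v)
    rw [map_zsmul]
    exact congrArg (c • ·) (hb g)
  -- `ι_E = ι_F ∘ cor`
  let ιE : continuousCohomology 2 ((mu F (p ^ k)).restrict (subgroupIncl (galFixing F E))).toTopRep →+
      ZMod (p ^ k) :=
    ιF.comp (cor (galFixing F E) (mu F (p ^ k)) 2).hom.toLinearMap.toAddMonoidHom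
  have hιE_apply : ∀ z, ιE z = ιF (cor (galFixing F E) (mu F (p ^ k)) 2 z) := fun _ => rfl
  have hιE : Injective ιE := by
    refine (injective_iff_map_eq_zero _).2 fun z hz => ?_
    have hcor : cor (galFixing F E) (mu F (p ^ k)) 2 z = 0 := (injective_iff_map_eq_zero ιF).1 hιF _ hz
    exact eq_zero_of_cor_two_mu_eq_zero F E hp.out hidx z
      ⟨k, nsmul_two_mu_eq_zero F (galFixing F E) (p ^ k) z⟩ hcor
  -- the line inputs over `Gal(F̄/E)` and `cd_p ≤ 2`
  have hlineSurj := fun (W : Type u) [AddCommGroup W] [TopologicalSpace W] [DiscreteTopology W] [Finite W]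
      (τ : ContinuousRep (galFixing F E) ℤ W) (hτ : ∀ (g : galFixing F E) (w : W), τ g w = w)
      (hW : Nat.card W = p) (μ' : continuousCohomology 2 τ.toTopRep →+ ZMod (p ^ k)) =>
    twoZero_surjective_line F E hpn hμ τ hτ hW ιE hιE μ'
  have h11r := fun (W : Type u) [AddCommGroup W] [TopologicalSpace W] [DiscreteTopology W] [Finite W]
      (τ : ContinuousRep (galFixing F E) ℤ W) (hτ : ∀ (g : galFixing F E) (w : W), τ g w = w)
      (hW : Nat.card W = p)
      (b : continuousCohomology 1 (τ.homRep ((mu F (p ^ k)).restrict (subgroupIncl (galFixing F E)))).toTopRep)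
      hb => dualityPairing_right_line F E hpn hμ τ hτ hW ιE hιE b hb
  have h3' : ∀ (X : Type u) [AddCommGroup X] [TopologicalSpace X] [DiscreteTopology X] [Finite X]
      (τ : ContinuousRep (galFixing F E) ℤ X), IsPrimaryTorsion p X → (∀ g ∈ N₀, ∀ x : X, τ g x = x) →
      Subsingleton (continuousCohomology 3 τ.toTopRep) :=
    fun X _ _ _ _ τ hX _ => subsingleton_continuousCohomology_galFixing_of_two_lt F E τ hX (by norm_num)
  -- over `E`
  have hN₀E : ∀ g ∈ N₀, ∀ m : M, ρ.restrict (subgroupIncl (galFixing F E)) g m = m := hN₀M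
  have surjE := ContinuousRep.twoZero_surjective_of_devissage
    ((mu F (p ^ k)).restrict (subgroupIncl (galFixing F E))) eΩ ιE N₀ hP hlineSurj h11r h3' M
    (ρ.restrict (subgroupIncl (galFixing F E))) hpM hM hN₀E
  obtain ⟨c, hc⟩ : ∃ c : ℤ, ∀ x : ZMod (p ^ k), (c * (galFixing F E).index) • x = x := by
    have hcop : Nat.Coprime (galFixing F E).index (p ^ k) :=
      Nat.Coprime.pow_right k ((Nat.Prime.coprime_iff_not_dvd hp.out).2 hidx).symm
    obtain ⟨a, b, hab⟩ := Nat.isCoprime_iff_coprime.2 hcop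
    refine ⟨a, fun x => ?_⟩
    have h1 : ((a * (galFixing F E).index : ℤ) : ZMod (p ^ k)) = 1 := by
      have h := congrArg (fun t : ℤ => (t : ZMod (p ^ k))) hab
      have hpk : ((p : ZMod (p ^ k)) ^ k) = 0 := by rw [← Nat.cast_pow, ZMod.natCast_self]
      push_cast at h ⊢
      rw [hpk, mul_zero, add_zero] at h
      exact h
    rw [zsmul_eq_mul, h1, one_mul]
  -- descent of surjectivity to `F`
  obtain ⟨f', hf', hsurj⟩ := surjE (lam.comp (cor (galFixing F E) ρ 2).hom.toLinearMap.toAddMonoidHom)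
  let φ := ((ρ.restrict (subgroupIncl (galFixing F E))).evalPairing
    ((mu F (p ^ k)).restrict (subgroupIncl (galFixing F E)))).flip.leftHom f' hf'
  let Nφ := normHom (galFixing F E) φ
  let fN : HomCarrier M (MuCarrier F (p ^ k)) :=
    HomCarrier.ofAddMonoidHom Nφ.hom.toLinearMap.toAddMonoidHom
  have hfN : ∀ g, ρ.homRep (mu F (p ^ k)) g fN = fN := fun g =>
    (ContinuousRep.homRep_apply_eq_self_iff _ _ g fN).2 fun m => (TopRep.hom_comm_apply Nφ g m).symm
  have key : ∀ z, ρ.twoZero (mu F (p ^ k)) ιF fN hfN z = (galFixing F E).index • lam z := by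
    intro z
    have e1 : ρ.twoZero (mu F (p ^ k)) ιF fN hfN z = ιF (cohomologyMap Nφ 2 z) := by
      obtain ⟨x, rfl⟩ := twoCocycleClass_surjective _ z
      rw [ContinuousRep.twoZero_apply, cohomologyMap_twoCocycleClass, cohomologyMap_twoCocycleClass]
      exact congrArg (fun y => ιF (twoCocycleClass _ y)) (Subtype.ext (ContinuousMap.ext fun _ => rfl))
    rw [e1, ← cor_cohomologyMap_resH (galFixing F E) ρ (mu F (p ^ k)) φ 1 z, ← hιE_apply,
      ← ContinuousRep.twoZero_apply, hsurj]
    change lam (cor (galFixing F E) ρ 2 (resH (galFixing F E) ρ 2 z)) = _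
    rw [cor_resH (galFixing F E) ρ 1 z, map_nsmul]
  have hcfN : ∀ g, ρ.homRep (mu F (p ^ k)) g (c • fN) = c • fN := fun g => by rw [map_zsmul, hfN g]
  refine ⟨c • fN, hcfN, AddMonoidHom.ext fun z => ?_⟩
  rw [ContinuousRep.twoZero_zsmul ρ (mu F (p ^ k)) ιF c fN hfN hcfN z, key, ← natCast_zsmul, smul_smul]
  exact hc _

/-- **Separation**: for a non-archimedean local field `F` of characteristic `0` and a finite discrete
`Γ_F`-module `M` killed by `p^k`, a NON-ZERO class `z ∈ H²(F, M)` is detected by an invariant element of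
the dual: there is `f ∈ Hom_{Γ_F}(M, μ_{p^k})` with `H²(ev_f) z ≠ 0` in `H²(F, μ_{p^k})`, `ev_f : M → μ_{p^k}`,
`m ↦ f m`. (From `twoZero_surjective_local`, an injective invariant map `H²(F, μ_{p^k}) ↪ ℤ/p^k`
— `exists_injective_iota_top` — and the fact that additive maps `H²(F, M) → ℤ/p^k` separate points.)
[cite: SerreGaloisCohomology1997, II §5.2 Thm. 2] [cite: MilneADT2006, I Cor. 2.3] -/
theorem exists_invariant_cohomologyMap_two_ne_zero {p k : ℕ} [hp : Fact p.Prime]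
    (ρ : ContinuousRep (absoluteGaloisGroup F) ℤ M) (hM : ∀ m : M, p ^ k • m = 0)
    {z : continuousCohomology 2 ρ.toTopRep} (hz : z ≠ 0) :
    ∃ (f : HomCarrier M (MuCarrier F (p ^ k))) (hf : ∀ g, ρ.homRep (mu F (p ^ k)) g f = f),
      cohomologyMap ((ρ.evalPairing (mu F (p ^ k))).flip.leftHom f hf) 2 z ≠ 0 := by
  haveI := absoluteGaloisGroup_compactSpace F
  haveI : NeZero (p ^ k) := ⟨pow_ne_zero k hp.out.ne_zero⟩
  haveI : Finite (MuCarrier F (p ^ k)) := finite_muCarrier F (p ^ k)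
  obtain ⟨ιF, hιF⟩ := exists_injective_iota_top F (p ^ k)
  have hH2n : ∀ z : continuousCohomology 2 ρ.toTopRep, (p ^ k) • z = 0 :=
    nsmul_continuousCohomology_two_eq_zero ρ.toTopRep (p ^ k) hM
  haveI : Finite (continuousCohomology 2 ρ.toTopRep) := (natCard_two_eq_natCard_invariants_homRep F ρ hM).1
  obtain ⟨lam, hlam⟩ := exists_addMonoidHom_zmod_apply_ne_zero hH2n hz
  obtain ⟨f, hf, hsurj⟩ := twoZero_surjective_local F ρ hM ιF hιF lam
  refine ⟨f, hf, fun h0 => hlam ?_⟩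
  rw [← hsurj, ContinuousRep.twoZero_apply, h0, map_zero]

end Local

end ContinuousRep

end Literature.NumberTheory.GaloisRepresentations

end
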